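import Mathlib
import Literature.Barriers.ValiantsHypothesis.AlgebraicNaturalProofs
import Summits.ValiantsHypothesis.ValiantsHypothesis.Theorems.BarrierLeverSuccinctHittingSetsForVPStubMultilinearBase
import Summits.ValiantsHypothesis.ValiantsHypothesis.Theorems.BarrierLeverSuccinctHittingSetsForVPStubMultilinearCoords
import Summits.ValiantsHypothesis.ValiantsHypothesis.Theorems.BarrierLeverSuccinctHittingSetsForVPStubMultilinearSparseGlue
import HarnessLib

/-!
# Crux `BarrierLever.SuccinctHittingSetsForVP` (stmt-ValiantsHypothesis-14610), line `registered` —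
SPARSE DISTINGUISHERS ARE HIT RELATIVE TO THE MULTILINEAR SLICE
(Forbes–Shpilka–Volk 2018 Thm. 9, sparse case, in its own multilinear regime; the
`P = multilinearSlice` case of the narrowed barrier `AlgebraicNaturalProofsNarrow` for sparse `𝒟`)

**What is proved (unconditional; structure/evidence, it does NOT close the item).** The barrier file
`Literature/Barriers/ValiantsHypothesis/AlgebraicNaturalProofs.lean` records (audit 2026-08-16) that
FSV Question 6 (`P = ⊤`) says nothing about distinguishers vanishing only on a SLICE `VP ∩ P`, and that
for `P = multilinearSlice` the relative hypothesis `SuccinctHittingSetsForVPRel F P` is open, FSV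
Thm. 9 covering only restricted `𝒟`. This file kernel-checks the sparse instance of exactly that:

* `isSuccinctHittingSetRel_multilinear_sparse` (= registered stub `stub_multilinearSparse`; assembly
  of the landed wave-4 stubs `stub_multilinearBase` p156897, `stub_multilinearCoords` p156800,
  `stub_multilinearSparseGlue` p157017): for every `a`, for all `n ≥ 8a + 2`, every polynomial `D` in
  the `N = C(2n,n)` coefficient variables with at most `N^a` monomials that is nonzero at the
  coefficient vector of SOME multilinear polynomial is nonzero at the coefficient vector of a
  MULTILINEAR member of `SmallCircuits ℂ n 3` (`IsSuccinctHittingSetRel (degLEMonomials n)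
  (multilinearSlice ℂ n) (SmallCircuits ℂ n 3) {D : |supp D| ≤ N^a}`).
* `succinctHittingSetsRel_multilinear_sparse`: the same in the `∀ a ∃ b n₀` shape of
  `SuccinctHittingSetsForVPRel`, for the distinguisher classes `Distinguishers ℂ n a ∩ {N^a-sparse}`.
* `not_naturalProofRel_multilinear_sparse`: consequently no `N^a`-SPARSE distinguisher is a
  multilinear-relative natural proof (FSV Def. 1 against `VP ∩ multilinear`, usefulness against size
  `n^b`, `b ≥ 3`) for any target — e.g. the permanent's slice of multilinear polynomials is not reached
  by sparse equations either.

Proof (FSV §5.1 verbatim, made succinct): kill the non-multilinear coordinates, transport to the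
polynomial ring on the `2^n` multilinear coordinates, apply FSV Lemma 32 with the all-ones shift
`coeff(∏(1 + x_i))` (landed `ShiftSmallSupport.exists_narrow_monomial` + `stub_prodSparsity`), take a
supported non-root, and hit with the multilinear small circuit `∏(1 + x_i) + Σ_{ν ∈ supp m} w_ν x^ν`.
Axioms: `propext`, `Classical.choice`, `Quot.sound`. References: [ForbesShpilkaVolk2018] Def. 1/3,
Thm. 9, Construction 29, Lemma 31–32, Cor. 34; barrier audit `AlgebraicNaturalProofsNarrow`.
-/

-- layout Summits/ValiantsHypothesis/ValiantsHypothesis forces the duplicated namespace component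
set_option linter.dupNamespace false

namespace Summit.ValiantsHypothesis.ValiantsHypothesis.Theorems.BarrierLever.SuccinctHittingSetsForVP

open Literature.Barriers.ValiantsHypothesis Literature.Computability.AlgebraicComplexity MvPolynomial

/-- **Sparse distinguishers are hit relative to the multilinear slice (FSV Thm. 9, sparse case,
multilinear regime).** For every `a` there is `n₀` such that for all `n ≥ n₀`, every `D` with at most
`C(2n,n)^a` monomials that is nonzero at the coefficient vector of some multilinear polynomial is
nonzero at the coefficient vector of a multilinear polynomial of degree `≤ n` and size `≤ n³`.
[cite: ForbesShpilkaVolk2018, Thm. 9 and Cor. 34] -/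
theorem isSuccinctHittingSetRel_multilinear_sparse :
    ∀ a : ℕ, ∃ n₀ : ℕ, ∀ n : ℕ, n₀ ≤ n →
      IsSuccinctHittingSetRel (degLEMonomials n) (multilinearSlice ℂ n) (SmallCircuits ℂ n 3)
        {D : MvPolynomial (degLEMonomials n) ℂ | D.support.card ≤ Nat.choose (2 * n) n ^ a} :=
  stub_multilinearSparseGlue stub_multilinearBase stub_multilinearCoords

/-- **Registered stub `stub_multilinearSparse`** (crux stmt-ValiantsHypothesis-14610, line
`registered`; wave 4 assembled): verbatim `isSuccinctHittingSetRel_multilinear_sparse`.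
[cite: ForbesShpilkaVolk2018, Thm. 9 and Cor. 34] -/
theorem stub_multilinearSparse :
    ∀ a : ℕ, ∃ n₀ : ℕ, ∀ n : ℕ, n₀ ≤ n →
      IsSuccinctHittingSetRel (degLEMonomials n) (multilinearSlice ℂ n) (SmallCircuits ℂ n 3)
        {D | D.support.card ≤ Nat.choose (2 * n) n ^ a} :=
  isSuccinctHittingSetRel_multilinear_sparse

/-- **In the shape of `SuccinctHittingSetsForVPRel`** restricted to sparse distinguishers: for every
level `a` there are `b` (`= 3`) and `n₀` such that for all `n ≥ n₀`, `SmallCircuits ℂ n b ∩ multilinear`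
hits, relative to the multilinear slice, every level-`a` distinguisher with at most `N^a` monomials.
[cite: ForbesShpilkaVolk2018, Thm. 9 and Question 6] -/
theorem succinctHittingSetsRel_multilinear_sparse :
    ∀ a : ℕ, ∃ b n₀ : ℕ, ∀ n : ℕ, n₀ ≤ n →
      IsSuccinctHittingSetRel (degLEMonomials n) (multilinearSlice ℂ n) (SmallCircuits ℂ n b)
        (Distinguishers ℂ n a ∩ {D | D.support.card ≤ Nat.choose (2 * n) n ^ a}) := by
  intro a
  obtain ⟨n₀, h⟩ := isSuccinctHittingSetRel_multilinear_sparse a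
  refine ⟨3, n₀, fun n hn D hD hg => ?_⟩
  exact h n hn D hD.2 hg

/-- **No sparse multilinear-relative natural proofs against `VP`.** For every `a`, eventually in `n`,
for every `b ≥ 3` and every target `h`: an `N^a`-sparse level-`a` distinguisher vanishing at the
coefficient vectors of all MULTILINEAR members of `SmallCircuits ℂ n b` vanishes at the coefficient
vector of every multilinear polynomial — so it certifies nothing about a multilinear target such as
the permanent (`NaturalProofAgainstVPRel` with `P = multilinearSlice` is unavailable to sparse `D`).
[cite: ForbesShpilkaVolk2018, Def. 1 and Thm. 9] -/
theorem not_naturalProofRel_multilinear_sparse (a : ℕ) : ∃ n₀ : ℕ, ∀ n : ℕ, n₀ ≤ n →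
    ∀ b : ℕ, 3 ≤ b → ∀ D ∈ Distinguishers ℂ n a, D.support.card ≤ Nat.choose (2 * n) n ^ a →
      (∀ f ∈ SmallCircuits ℂ n b, f ∈ multilinearSlice ℂ n →
        eval (coeffVector (degLEMonomials n) f) D = 0) →
      ∀ g ∈ multilinearSlice ℂ n, eval (coeffVector (degLEMonomials n) g) D = 0 := by
  obtain ⟨n₀, h⟩ := isSuccinctHittingSetRel_multilinear_sparse a
  refine ⟨max n₀ 1, fun n hn b hb D _ hsparse hvan g hg => ?_⟩
  have hn₀ : n₀ ≤ n := le_trans (le_max_left _ _) hn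
  have hn1 : 1 ≤ n := le_trans (le_max_right _ _) hn
  by_contra hne
  obtain ⟨f, hf, hfml, hfne⟩ := h n hn₀ D hsparse ⟨g, hg, hne⟩
  exact hfne (hvan f (smallCircuits_mono ℂ hb hn1 hf) hfml)

end Summit.ValiantsHypothesis.ValiantsHypothesis.Theorems.BarrierLever.SuccinctHittingSetsForVP
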